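import Summits.QuantumFields.BalabanUV.Beta.GAN24.FaceDataVHNull
import Summits.QuantumFields.BalabanUV.Beta.HessKerDressedUnits

/-!
# `BalabanUV.Beta.GAN24.FaceWordVHNullCurrents` — binder row G-an2-4 ∕ (CONV-C), W-slot (α-0), typer's PART VI row **T6-VAL**, the (γ) hand's letters **K7-a ∕ K7-0, THE SECTOR SPLIT
# (α) OF THE ADAPTER, INSTANTIATED**: **THE TWO-FACE CURRENTS OF road-P2's UNIT-SCALED VH-SECTOR TABLE `unitS sf sm (c' • vhSAt ρ d Lc)` AT ANY COARSER FACE PERIOD `Lc·P` VANISH IN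
# BOTH LEG POSITIONS** — the `hnullL` ∕ `hnullR` hypotheses of this seat's `FaceWordNullSector.faceWord_eq_cellPairing_of_null` for `S₂ =` the VH sector of `S♮_j` (`c' = cVH` at level `0`,
# `cVH·wVH` at the higher levels; every `d`, in-block root, `Lc ≥ 1`, every `P`, all units), from this lineage's `FaceDataVHNull.vhSAt_faceData_eq_zero ∕ _zero'` (g56, p382934): face
# data at period `Lc·P` vanishes off the `Lc`-faces (`emod_face_of_dvd`)
# (G-an2-4 CRUX TEAM (2), seat `b2b-balaban-gan24-formalise-leaf-06` = the (γ) hand, gen 57; journal [GAN24LEAF06-G57-INTENT-5])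

NOT IN PRINT; OUR BOOKKEEPING ([folklore] BY NAME over g56's `FaceDataVHNull` + an2's `HessKerDressedUnits.unitS_apply`; 0 `def`, 0 cited fact, 0 `def … : Prop`, 0 sorry).
HONEST FRAMING (cell contract, verbatim): «discharging `BetaPertH` makes Bałaban's UV stability UNCONDITIONAL — a real constructive-QFT result; it is NOT the continuum
limit and NOT the Clay problem.»  HONEST DEPENDENCY (verbatim): «continuum YM on T⁴ ⇐ BetaPertH ∧ nine spine estimates (0/9 proved); BetaPertH ⇐ (D1) ∧ (D4) ∧ CAP+tail;
G-an2-4 gates asym, D1 and NE2/3/4.»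

WHAT ([folklore]): §1 `emod_face_of_dvd` (`n mod (Lc·P) = Lc·P − 1 ⟹ n mod Lc = Lc − 1`), `faceInd_eq_zero_of_ne`; `unitS_smul_vhSAt_entry` (the scalar on an entry); §2 **`vhSector_nullL`**
(weighted leg first, free leg `(x, f)` second) and **`vhSector_nullR`** (free leg `(z, g)` first, weighted leg second).  Asserts NO value of any table; discharges NOTHING of `hX` ∕ `hXu` ∕
(C) ∕ `hB0` ∕ `hBF` ∕ (Q-L); NEVER «G-an2-4 closed» as (CONV-C); NOT D1, NOT `BetaPertH`, NOT continuum, NOT Clay.  2026-08-24; no existing file touched.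
-/

noncomputable section

open scoped BigOperators
open Literature.MathematicalPhysics.QuantumFieldTheory.Balaban1983to89
open Literature.MathematicalPhysics.QuantumFieldTheory.Balaban1983to89.Beta
open AffineAveraging AveragingHessianKernelsRooted
open OneStepResolventKernel (Fib)
open Summit.QuantumFields.BalabanUV.Beta.HessKerDressedUnits (unitS unitS_apply legScale legScale_inl)
open Summit.QuantumFields.BalabanUV.Beta.GAN24.FaceDataVHNull (vhSAt_faceData_eq_zero vhSAt_faceData_eq_zero')

namespace Summit.QuantumFields.BalabanUV.Beta.GAN24.FaceWordVHNullCurrents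

variable {d : ℕ} {Lc : ℕ}

/-! ## §1 Face data at a coarser period vanishes off the `Lc`-faces; the scalar on an entry -/

/-- [folklore] **A FACE RESIDUE AT PERIOD `Lc·P` IS A FACE RESIDUE AT PERIOD `Lc`** (`Lc ≥ 1`): `n mod (Lc·P) = Lc·P − 1 ⟹ n mod Lc = Lc − 1`. -/
theorem emod_face_of_dvd (hLc : 1 ≤ Lc) {P : ℕ} {n : ℤ} (h : n % ((Lc * P : ℕ) : ℤ) = ((Lc * P : ℕ) : ℤ) - 1) : n % (Lc : ℤ) = (Lc : ℤ) - 1 := by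
  have hdvd : (Lc : ℤ) ∣ ((Lc * P : ℕ) : ℤ) := ⟨(P : ℤ), by push_cast; ring⟩
  rw [← Int.emod_emod_of_dvd n hdvd, h]
  have e : ((Lc * P : ℕ) : ℤ) - 1 = ((Lc : ℤ) - 1) + (Lc : ℤ) * ((P : ℤ) - 1) := by push_cast; ring
  rw [e, Int.add_mul_emod_self_left]
  exact Int.emod_eq_of_lt (by omega) (by omega)

/-- [folklore] Hence the period-`(Lc·P)` face indicator vanishes wherever the period-`Lc` face test fails. -/
theorem faceInd_eq_zero_of_ne (hLc : 1 ≤ Lc) (P : ℕ) (n : ℤ) (hn : n % (Lc : ℤ) ≠ (Lc : ℤ) - 1) :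
    (if n % ((Lc * P : ℕ) : ℤ) = ((Lc * P : ℕ) : ℤ) - 1 then (1 : ℝ) else 0) = 0 := by
  rw [if_neg]
  exact fun h => hn (emod_face_of_dvd hLc h)

/-- [folklore] **THE SCALAR ON AN ENTRY OF THE UNIT-SCALED VH SECTOR**: `unitS sf sm (c' • vhSAt) κ u x z a b = ((sf·sm)⁻¹·ℓ(a)·c'·ℓ(b))·vhSAt κ u x z a b`, `ℓ = legScale sf⁻¹ sm⁻¹`. -/
theorem unitS_smul_vhSAt_entry {r : Fin (d + 1) → ℕ} (sf sm c' : ℝ) (κ : Fin (d + 1)) (u x z : Fin (d + 1) → ℤ) (a b : Fib d) :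
    unitS sf sm (fun κ u => c' • vhSAt (toSite r) d Lc rfl κ u) κ u x z a b =
      ((sf * sm)⁻¹ * legScale (d := d) sf⁻¹ sm⁻¹ a * c' * legScale (d := d) sf⁻¹ sm⁻¹ b) * vhSAt (toSite r) d Lc rfl κ u x z a b := by
  rw [unitS_apply]
  simp only [Pi.smul_apply, smul_eq_mul]
  ring

/-! ## §2 The VH sector's two-face currents at period `Lc·P` vanish in both leg positions -/

/-- NOT IN PRINT; OUR BOOKKEEPING.  **LEFT NULL CURRENT** (the `hnullL` of `FaceWordNullSector.faceWord_eq_cellPairing_of_null`): for every free leg `(x, f)`,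
`Σ'_y χ(y_α)·Σ'_t [t_μ % (Lc·P) = Lc·P − 1]·(unitS sf sm (c' • vhSAt ρ d Lc)) μ t y x (inl α) f = 0` (in-block root, `Lc ≥ 1`). -/
theorem vhSector_nullL (hLc : 1 ≤ Lc) {r : Fin (d + 1) → ℕ} (hr : r ∈ box (d + 1) Lc) (P : ℕ) (sf sm c' : ℝ) (μ α : Fin (d + 1))
    (x : Fin (d + 1) → ℤ) (f : Fib d) :
    (∑' y : Fin (d + 1) → ℤ, (if y α % ((Lc * P : ℕ) : ℤ) = ((Lc * P : ℕ) : ℤ) - 1 then (1 : ℝ) else 0) *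
        ∑' t : Fin (d + 1) → ℤ, (if t μ % ((Lc * P : ℕ) : ℤ) = ((Lc * P : ℕ) : ℤ) - 1 then unitS sf sm (fun κ u => c' • vhSAt (toSite r) d Lc rfl κ u) μ t y x (Sum.inl α) f else 0)) = 0 := by
  have hin : ∀ y : Fin (d + 1) → ℤ, (∑' t : Fin (d + 1) → ℤ, (if t μ % ((Lc * P : ℕ) : ℤ) = ((Lc * P : ℕ) : ℤ) - 1 then unitS sf sm (fun κ u => c' • vhSAt (toSite r) d Lc rfl κ u) μ t y x (Sum.inl α) f else 0)) =
      ((sf * sm)⁻¹ * legScale (d := d) sf⁻¹ sm⁻¹ (Sum.inl α) * c' * legScale (d := d) sf⁻¹ sm⁻¹ f) *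
        ∑' t : Fin (d + 1) → ℤ, (if t μ % ((Lc * P : ℕ) : ℤ) = ((Lc * P : ℕ) : ℤ) - 1 then (1 : ℝ) else 0) * vhSAt (toSite r) d Lc rfl μ t y x (Sum.inl α) f := by
    intro y
    rw [← tsum_mul_left]
    refine tsum_congr fun t => ?_
    rw [unitS_smul_vhSAt_entry]
    split_ifs <;> ring
  simp_rw [hin]
  have hpull : (∑' y : Fin (d + 1) → ℤ, (if y α % ((Lc * P : ℕ) : ℤ) = ((Lc * P : ℕ) : ℤ) - 1 then (1 : ℝ) else 0) *
      (((sf * sm)⁻¹ * legScale (d := d) sf⁻¹ sm⁻¹ (Sum.inl α) * c' * legScale (d := d) sf⁻¹ sm⁻¹ f) *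
        ∑' t : Fin (d + 1) → ℤ, (if t μ % ((Lc * P : ℕ) : ℤ) = ((Lc * P : ℕ) : ℤ) - 1 then (1 : ℝ) else 0) * vhSAt (toSite r) d Lc rfl μ t y x (Sum.inl α) f)) =
      ((sf * sm)⁻¹ * legScale (d := d) sf⁻¹ sm⁻¹ (Sum.inl α) * c' * legScale (d := d) sf⁻¹ sm⁻¹ f) *
        ∑' y : Fin (d + 1) → ℤ, (if y α % ((Lc * P : ℕ) : ℤ) = ((Lc * P : ℕ) : ℤ) - 1 then (1 : ℝ) else 0) *
          ∑' t : Fin (d + 1) → ℤ, (if t μ % ((Lc * P : ℕ) : ℤ) = ((Lc * P : ℕ) : ℤ) - 1 then (1 : ℝ) else 0) * vhSAt (toSite r) d Lc rfl μ t y x (Sum.inl α) f := by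
    rw [← tsum_mul_left]
    exact tsum_congr fun y => by ring
  rw [hpull, vhSAt_faceData_eq_zero hLc hr μ α (faceInd_eq_zero_of_ne hLc P) (faceInd_eq_zero_of_ne hLc P) x f, mul_zero]

/-- NOT IN PRINT; OUR BOOKKEEPING.  **RIGHT NULL CURRENT** (the `hnullR`): for every free leg `(z, g)`,
`Σ'_w χ(w_β)·Σ'_t [t_ν % (Lc·P) = Lc·P − 1]·(unitS sf sm (c' • vhSAt ρ d Lc)) ν t z w g (inl β) = 0`. -/
theorem vhSector_nullR (hLc : 1 ≤ Lc) {r : Fin (d + 1) → ℕ} (hr : r ∈ box (d + 1) Lc) (P : ℕ) (sf sm c' : ℝ) (ν β : Fin (d + 1))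
    (z : Fin (d + 1) → ℤ) (g : Fib d) :
    (∑' w : Fin (d + 1) → ℤ, (if w β % ((Lc * P : ℕ) : ℤ) = ((Lc * P : ℕ) : ℤ) - 1 then (1 : ℝ) else 0) *
        ∑' t : Fin (d + 1) → ℤ, (if t ν % ((Lc * P : ℕ) : ℤ) = ((Lc * P : ℕ) : ℤ) - 1 then unitS sf sm (fun κ u => c' • vhSAt (toSite r) d Lc rfl κ u) ν t z w g (Sum.inl β) else 0)) = 0 := by
  have hin : ∀ w : Fin (d + 1) → ℤ, (∑' t : Fin (d + 1) → ℤ, (if t ν % ((Lc * P : ℕ) : ℤ) = ((Lc * P : ℕ) : ℤ) - 1 then unitS sf sm (fun κ u => c' • vhSAt (toSite r) d Lc rfl κ u) ν t z w g (Sum.inl β) else 0)) =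
      ((sf * sm)⁻¹ * legScale (d := d) sf⁻¹ sm⁻¹ g * c' * legScale (d := d) sf⁻¹ sm⁻¹ (Sum.inl β)) *
        ∑' t : Fin (d + 1) → ℤ, (if t ν % ((Lc * P : ℕ) : ℤ) = ((Lc * P : ℕ) : ℤ) - 1 then (1 : ℝ) else 0) * vhSAt (toSite r) d Lc rfl ν t z w g (Sum.inl β) := by
    intro w
    rw [← tsum_mul_left]
    refine tsum_congr fun t => ?_
    rw [unitS_smul_vhSAt_entry]
    split_ifs <;> ring
  simp_rw [hin]
  have hpull : (∑' w : Fin (d + 1) → ℤ, (if w β % ((Lc * P : ℕ) : ℤ) = ((Lc * P : ℕ) : ℤ) - 1 then (1 : ℝ) else 0) *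
      (((sf * sm)⁻¹ * legScale (d := d) sf⁻¹ sm⁻¹ g * c' * legScale (d := d) sf⁻¹ sm⁻¹ (Sum.inl β)) *
        ∑' t : Fin (d + 1) → ℤ, (if t ν % ((Lc * P : ℕ) : ℤ) = ((Lc * P : ℕ) : ℤ) - 1 then (1 : ℝ) else 0) * vhSAt (toSite r) d Lc rfl ν t z w g (Sum.inl β))) =
      ((sf * sm)⁻¹ * legScale (d := d) sf⁻¹ sm⁻¹ g * c' * legScale (d := d) sf⁻¹ sm⁻¹ (Sum.inl β)) *
        ∑' w : Fin (d + 1) → ℤ, (if w β % ((Lc * P : ℕ) : ℤ) = ((Lc * P : ℕ) : ℤ) - 1 then (1 : ℝ) else 0) *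
          ∑' t : Fin (d + 1) → ℤ, (if t ν % ((Lc * P : ℕ) : ℤ) = ((Lc * P : ℕ) : ℤ) - 1 then (1 : ℝ) else 0) * vhSAt (toSite r) d Lc rfl ν t z w g (Sum.inl β) := by
    rw [← tsum_mul_left]
    exact tsum_congr fun w => by ring
  rw [hpull, vhSAt_faceData_eq_zero' hLc hr ν β (faceInd_eq_zero_of_ne hLc P) (faceInd_eq_zero_of_ne hLc P) z g, mul_zero]

end Summit.QuantumFields.BalabanUV.Beta.GAN24.FaceWordVHNullCurrents

end
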